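import Summits.ValiantsHypothesis.ValiantsHypothesis.Theorems.FeketeSOSFeketeSOSHardPaleyRIPSymOuterNuclear
import Summits.ValiantsHypothesis.ValiantsHypothesis.Theorems.FeketeSOSFeketeSOSHardPaleyRIPProgressionBlocks

/-!
# Route FeketeSOS — crux `FeketeSOSHard` (stmt-ValiantsHypothesis-3996), line `paley-rip` v3,
# `stub_tameOperator` on direct sumsets, piece 2: `r` weighted squares on ANY support `D` re-represented at
# mass `≤ √r · ‖C‖_F` (squares vocabulary of the stub)

Transport of `symOuter_nuclear_le` (`…PaleyRIPSymOuterNuclear.lean`: a rank-`≤ r` symmetric tensor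
`C = Σ_i c_i v_i v_iᵀ` is `Σ_j λ_j g_j g_jᵀ` with `Σ_j |λ_j|‖g_j‖² ≤ √r ‖C‖_F`) to the vocabulary of
`stub_tameOperator` (`Cruxes/FeketeSOSHard/Lines/paley_rip_v3.lean`): weighted squares `(c_i, V_i)_{i<r}` with
`supp V_i ⊆ D` have the pattern `Σ_i c_i V_i² = Σ_{d,d'} C_{dd'} X^{d+d'}`, `C_{dd'} = Σ_i c_i V_i(d) V_i(d')`, and

* `lowRank_rep` — there are weighted squares `(c'_j, g_j)` with `supp g_j ⊆ D`, the SAME pattern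
  `Σ_j c'_j g_j² = Σ_i c_i V_i²` (exactly, as polynomials) and mass `Σ_j |c'_j|‖g_j‖₂² ≤ √r · ‖C‖_F`,
  `‖C‖_F = (Σ_{d,d'∈D} |C_{dd'}|²)^{1/2}` — for EVERY finite `D` (no additive hypothesis).

On a Sidon set `D` one has `‖C‖_F ≤ ‖pattern‖₂`, so this is `stub_tameOperator` on Sidon supports at all
ranks with constant `√r` (cf. `…PaleyRIPRankTwoSidon.lean`, `r = 2`); its use here is at each Fourier
frequency of the direct-sumset theorem (`Cruxes/FeketeSOSHard/TameOperatorDplusH.md` §Proof (2), with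
`√r‖C_ω‖_F` now obtained without Takagi).  Also: `coeff_sum_C_mul_X_pow`, `support_sum_C_mul_X_pow_subset`
(polynomials from coefficient vectors on `D`).

Honest framing (rung currency): Theorems-side helper `--supports` stmt-3996; nothing here closes a registered
stub; `stub_tameOperator`, `stub_paleyFlatRIP` and the crux stay OPEN; `VP ≠ VNP` is untouched.
-/

set_option linter.dupNamespace false

namespace Summit.ValiantsHypothesis.ValiantsHypothesis.Theorems.FeketeSOSHardPaleyRIP

open Polynomial Finset
open scoped BigOperators

noncomputable section

/-! ## Polynomials from coefficient vectors on a finite set -/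

/-- Coefficients of `Σ_{d∈D} f(d) X^d`. [folklore] -/
theorem coeff_sum_C_mul_X_pow (D : Finset ℕ) (f : ℕ → ℂ) (n : ℕ) :
    (∑ d ∈ D, C (f d) * (X : ℂ[X]) ^ d).coeff n = if n ∈ D then f n else 0 := by
  rw [finsetSum_coeff]
  simp only [coeff_C_mul_X_pow]
  rw [Finset.sum_ite_eq D n]

/-- `Σ_{d∈D} f(d) X^d` is supported in `D`. [folklore] -/
theorem support_sum_C_mul_X_pow_subset (D : Finset ℕ) (f : ℕ → ℂ) :
    (∑ d ∈ D, C (f d) * (X : ℂ[X]) ^ d).support ⊆ D := by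
  intro n hn
  rw [mem_support_iff, coeff_sum_C_mul_X_pow] at hn
  by_contra h
  exact hn (if_neg h)

/-- The `ℓ²`-mass of `Σ_{d∈D} f(d) X^d` weighted by `|c|` is `|c| Σ_{d∈D} |f d|²`. [folklore] -/
theorem sqMass_sum_C_mul_X_pow (D : Finset ℕ) (c : ℂ) (f : ℕ → ℂ) :
    sqMass c (∑ d ∈ D, C (f d) * (X : ℂ[X]) ^ d) = ‖c‖ * ∑ d ∈ D, ‖f d‖ ^ 2 := by
  rw [sqMass_eq_of_support_subset c _ D (support_sum_C_mul_X_pow_subset D f)]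
  congr 1
  refine Finset.sum_congr rfl fun d hd => ?_
  rw [coeff_sum_C_mul_X_pow, if_pos hd]

/-! ## `r` weighted squares on `D` cost at most `√r · ‖C‖_F` -/

/-- **Low-rank patterns are cheap on any support (`√r · Frobenius`).**  For weighted squares `(c_i, V_i)_{i<r}`
with `supp V_i ⊆ D` there are weighted squares `(c'_j, g_j)` with `supp g_j ⊆ D`, the same pattern
`Σ_j c'_j g_j² = Σ_i c_i V_i²`, and `Σ_j |c'_j|·‖g_j‖₂² ≤ √r · (Σ_{d,d'∈D} |Σ_i c_i V_i(d)V_i(d')|²)^{1/2}`.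
[folklore] -/
theorem lowRank_rep (D : Finset ℕ) (r : ℕ) (c : Fin r → ℂ) (V : Fin r → ℂ[X])
    (hV : ∀ i, (V i).support ⊆ D) :
    ∃ (s : ℕ) (c' : Fin s → ℂ) (g : Fin s → ℂ[X]), (∀ j, (g j).support ⊆ D) ∧
      (∑ j, C (c' j) * g j ^ 2) = ∑ i, C (c i) * V i ^ 2 ∧
      (∑ j, sqMass (c' j) (g j)) ≤ Real.sqrt r *
        Real.sqrt (∑ d ∈ D, ∑ d' ∈ D, ‖∑ i, c i * ((V i).coeff d * (V i).coeff d')‖ ^ 2) := by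
  classical
  -- coefficient vectors on the index type `↥D`
  obtain ⟨s, lam, g, hId, hMass⟩ :=
    symOuter_nuclear_le (ι := ↥D) r c (fun i d => (V i).coeff (d : ℕ))
  -- back to polynomials: extend the vectors by zero off `D`
  let gN : Fin s → ℕ → ℂ := fun j n => if h : n ∈ D then g j ⟨n, h⟩ else 0
  have hgN : ∀ j (d : ↥D), gN j (d : ℕ) = g j d := fun j d => by
    simp only [gN, dif_pos d.2]
  let G : Fin s → ℂ[X] := fun j => ∑ d ∈ D, C (gN j d) * (X : ℂ[X]) ^ d
  have hGcoeff : ∀ j n, (G j).coeff n = gN j n := by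
    intro j n
    rw [coeff_sum_C_mul_X_pow]
    by_cases hn : n ∈ D
    · rw [if_pos hn]
    · rw [if_neg hn]; simp only [gN, dif_neg hn]
  have hVcoeff : ∀ i n, n ∉ D → (V i).coeff n = 0 := fun i n hn =>
    notMem_support_iff.1 fun h => hn (hV i h)
  -- entrywise identity on all of `ℕ × ℕ`
  have hkey : ∀ a b : ℕ, ∑ j, lam j * ((G j).coeff a * (G j).coeff b) =
      ∑ i, c i * ((V i).coeff a * (V i).coeff b) := by
    intro a b
    by_cases ha : a ∈ D
    · by_cases hb : b ∈ D
      · have h := hId ⟨a, ha⟩ ⟨b, hb⟩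
        simp only [hGcoeff, ← hgN] at h ⊢
        exact h
      · simp only [hGcoeff, hVcoeff _ b hb, mul_zero, Finset.sum_const_zero]
        simp only [gN, dif_neg hb, mul_zero, Finset.sum_const_zero]
    · simp only [hGcoeff, hVcoeff _ a ha, zero_mul, mul_zero, Finset.sum_const_zero]
      simp only [gN, dif_neg ha, zero_mul, mul_zero, Finset.sum_const_zero]
  refine ⟨s, lam, G, fun j => support_sum_C_mul_X_pow_subset D (gN j), ?_, ?_⟩
  · -- same pattern
    ext n
    rw [finsetSum_coeff, finsetSum_coeff]
    simp only [coeff_C_mul]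
    simp only [pow_two, coeff_mul, Finset.mul_sum]
    rw [Finset.sum_comm, Finset.sum_comm (s := Finset.univ)]
    exact Finset.sum_congr rfl fun x _ => hkey x.1 x.2
  · -- mass
    have hm : ∀ j, sqMass (lam j) (G j) = ‖lam j‖ * ∑ d : ↥D, ‖g j d‖ ^ 2 := by
      intro j
      rw [sqMass_sum_C_mul_X_pow, ← Finset.sum_coe_sort D]
      simp only [hgN]
    have hF : (∑ d ∈ D, ∑ d' ∈ D, ‖∑ i, c i * ((V i).coeff d * (V i).coeff d')‖ ^ 2) =
        ∑ a : ↥D, ∑ b : ↥D, ‖∑ i, c i * ((V i).coeff (a : ℕ) * (V i).coeff (b : ℕ))‖ ^ 2 := by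
      rw [← Finset.sum_coe_sort D]
      exact Finset.sum_congr rfl fun a _ => by rw [← Finset.sum_coe_sort D]
    rw [Finset.sum_congr rfl fun j _ => hm j, hF]
    exact hMass

end

end Summit.ValiantsHypothesis.ValiantsHypothesis.Theorems.FeketeSOSHardPaleyRIP
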